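import Literature.Geometry.Lorentzian.KerrDerivativeDecay
import Literature.Geometry.Lorentzian.KerrStarCoord
import HarnessLib

/-!
# DRSR Corollary 3.1 (31): the coordinate form and the printed leaf form are equivalent

(statement group **gr.S24**; namespace `Literature.Geometry.Lorentzian`, Kerr-specific corollaries
in `Literature.Geometry.Lorentzian.Kerr`)

`KerrDerivativeDecay.lean` reduces the named fact
`Literature.Geometry.Lorentzian.drsr_wave_derivative_decay_kerr` (`KerrWaveDecay.lean`;
Dafermos–Rodnianski–Shlapentokh-Rothman, arXiv:1402.7034 = Ann. of Math. 183 (2016), "DRSR",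
Cor. 3.1, estimate (31): `sup_{Σ̃_τ ∩ {r ≤ R}} |n_Σ̃ ψ| + |∇_Σ̃ ψ| ≤ C E τ^{-2+δ}`) to the printed
estimate read through the leaves `Σ̃_τ(h)` of a cut-off graph foliation
(`drsr_wave_derivative_decay_kerr_of_leaf_derivative_decay`; `h = Kerr.cutoffHeight (σ M a) a R₁`
vanishes on `{r ≤ R₁}`, so that there the leaves are the Kerr–Schild slices `{t*_KS = τ}` — the
printed choice, DRSR p. 51: "a hyperboloidal hypersurface which agrees with `Σ₀` on `{r ≤ R}`").
This file records that the reduction uses only the **flat part** `{r < R₁}` of the leaves and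
that, restricted to it, the leaf form is **equivalent** to the named fact — the analogue for (31)
of `drsr_wave_pointwise_decay_kerr_iff_leaf_pointwise_decay` (`KerrPointwiseDecay.lean`) for (30):

* `drsr_wave_derivative_decay_kerr_of_leaf_derivative_decay_lt` (**proved**): the forward
  reduction from the leaf form with hypothesis restricted to radii `r₊ < R < R₁` (same proof as in
  `KerrDerivativeDecay.lean`, choosing the flat radius `R₁` beyond `max(R, r₊ + 1) + 1`);
* `leaf_derivative_decay_of_drsr_wave_derivative_decay_kerr` (**proved**): the converse — at an
  exterior leaf point `p` with `r(p) ≤ R < R₁` the leaf is the slice and its normal is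
  `V = −g♯(dt*)` (`Kerr.leafNormal_eq_timeVector`), `‖y‖ ≤ r + |a| ≤ R₁ + |a|`
  (`Kerr.norm_le_radius_add_abs`), and the converse comparison on the subextremal exterior
  `(nψ)² + |∇_Σψ|²_ḡ ≤ 30 ∑_μ (∂_μψ)²`
  (`Kerr.unitNormalDeriv_sq_add_tangentialGradSq_le_thirty_mul_coordEnergyDensity`) turns
  `∑_μ (∂_μψ)² ≤ C τ^{-4+2δ}` into `|nψ| + |∇_Σψ|_ḡ ≤ √(60 max(C, 0)) τ^{-2+δ}`;
* `drsr_wave_derivative_decay_kerr_iff_leaf_derivative_decay` (**proved**) and, for the foliation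
  `Σ̃_τ(h♯_{R₁})` terminating at `𝓘⁺` (`σ = Kerr.scriSlope`),
  `Kerr.scri_leaf_derivative_decay_of_drsr_wave_derivative_decay_kerr`,
  `Kerr.scri_leaf_derivative_decay_iff` (**proved**).

Consequently the named fact asserts *exactly* the printed estimate (31) on the region where DRSR
invoke it (compactly supported data, hyperboloidal leaves agreeing with the slices on `{r ≤ R₁}`,
`R < R₁`): it is neither stronger nor weaker than its source there. On the bent part `{r > R₁}` the
printed quantity refers to the normal of the bent leaf; comparing it with the coordinate gradient
would need the uniform spacelikeness of the leaves on compact sets (true for `Σ̃_τ(h♯_{R₁})`,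
`Kerr.leafConormal_coSharp_self_neg`, but needed by neither direction and not carried out). No
definition and no named fact is introduced (D-0026: written from the proving seat of
`drsr_wave_derivative_decay_kerr`; the remaining input of that fact is the higher-order local
energy decay isolated in `KerrDerivativeDecaySobolev.lean`).

## References

* M. Dafermos, I. Rodnianski, Y. Shlapentokh-Rothman, *Decay for solutions of the wave equation
  on Kerr exterior spacetimes III: the full subextremal case `|a| < M`*, Ann. of Math. 183 (2016)
  787–913, arXiv:1402.7034: §3.1 (display following (23): `J^N_μ n^μ ∼ |∂ψ|²`), §3.3 (Cor. 3.1,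
  estimate (31)), p. 51 (hyperboloidal `Σ̃₀` agreeing with `Σ₀` on `{r ≤ R}`)
  (key `DafermosRodnianskiShlapentokhrothman2014`).
* M. Visser, *The Kerr spacetime: a brief introduction*, arXiv:0706.0622, (35)
  (`r² = ‖x⃗‖² − a² sin²θ`) (key `arXiv07060622`).
-/

noncomputable section

open Set Filter TopologicalSpace Metric
open scoped Manifold ContDiff Topology ENNReal

namespace Literature.Geometry.Lorentzian

/-! ### The forward reduction from the flat part of the leaves -/

/-- **Reduction of DRSR's pointwise derivative decay (coordinate form) to (31) on the flat part
of the leaves of a cut-off graph foliation** (the form of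
`drsr_wave_derivative_decay_kerr_of_leaf_derivative_decay` whose hypothesis is restricted to the
radii `r₊ < R < R₁`, where the leaves `Σ̃_τ(h)`, `h = Kerr.cutoffHeight (σ M a) a R₁`, *are* the
Kerr–Schild slices `{t*_KS = τ}`: DRSR arXiv:1402.7034, p. 51, "a hyperboloidal hypersurface which
agrees with `Σ₀` on `{r ≤ R}`"). This is all the reduction uses: given an admissible `ψ` with data
supported in `{‖x⃗‖ ≤ ρ}` and a coordinate radius `R`, put `R' = max(R, r₊ + 1)` and choose
`R₁ = max(R₀, ρ, R' + 1) > R'`; at a slice point `(τ, y)` with `‖y‖ ≤ R` one has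
`r ≤ ‖y‖ ≤ R ≤ R' < R₁` (`Kerr.radius_ofTimeSpace_le_norm`), so the leaf through it is the slice,
its normal is `V` (`Kerr.leafNormal_eq_timeVector`), and
`∑_μ (∂_μψ)² ≤ 6 (|nψ| + |∇_Σψ|_ḡ)² ≤ 6 C² τ^{-4+2δ}`
(`Kerr.coordEnergyDensity_le_six_mul_sq_unitNormalDeriv_add_sqrt_tangentialGradSq`). With the
converse `leaf_derivative_decay_of_drsr_wave_derivative_decay_kerr` below, the restricted leaf form
is *equivalent* to the named fact (`drsr_wave_derivative_decay_kerr_iff_leaf_derivative_decay`).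
DRSR arXiv:1402.7034, §3.3, Cor. 3.1 (31) and p. 51. [cite: DafermosRodnianskiShlapentokhrothman2014, Cor. 3.1 (31) and p. 51] -/
theorem drsr_wave_derivative_decay_kerr_of_leaf_derivative_decay_lt (σ : ℝ → ℝ → ℝ → ℝ)
    (h31 : ∀ [Kerr.Facts] [Kerr.SliceFacts] (M a : ℝ), Kerr.IsSubextremal M a →
      ∃ R₀ : ℝ, 0 < R₀ ∧ ∀ R₁ : ℝ, R₀ ≤ R₁ →
        ∀ ψ : Kerr.region a (Kerr.rPlus M a) → ℝ, IsAdmissibleKerrWave M a ψ →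
          Kerr.HasBallData M a R₁ ψ → ∀ δ : ℝ, 0 < δ → ∀ R : ℝ, Kerr.rPlus M a < R → R < R₁ →
            ∃ C : ℝ, ∀ τ : ℝ, 1 ≤ τ →
              ∀ (y : E3) (hy : Kerr.leafPoint (Kerr.cutoffHeight (σ M a) a R₁) τ y ∈
                  Kerr.region a (Kerr.rPlus M a)),
                Kerr.radius a (Kerr.leafPoint (Kerr.cutoffHeight (σ M a) a R₁) τ y) ≤ R →
                  |(Kerr.smoothMetric M a (Kerr.rPlus M a)).unitNormalDeriv ψ
                      ⟨Kerr.leafPoint (Kerr.cutoffHeight (σ M a) a R₁) τ y, hy⟩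
                      (Kerr.leafNormal M a (Kerr.cutoffHeight (σ M a) a R₁)
                        ⟨Kerr.leafPoint (Kerr.cutoffHeight (σ M a) a R₁) τ y, hy⟩)| +
                    Real.sqrt ((Kerr.smoothMetric M a (Kerr.rPlus M a)).tangentialGradSq ψ
                      ⟨Kerr.leafPoint (Kerr.cutoffHeight (σ M a) a R₁) τ y, hy⟩
                      (Kerr.leafNormal M a (Kerr.cutoffHeight (σ M a) a R₁)
                        ⟨Kerr.leafPoint (Kerr.cutoffHeight (σ M a) a R₁) τ y, hy⟩)) ≤
                    C * τ ^ (-2 + δ)) :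
    drsr_wave_derivative_decay_kerr := by
  intro _ _ M a hMa ψ hψ δ hδ R
  obtain ⟨R₀, hR₀, hcor⟩ := h31 M a hMa
  -- a coordinate ball containing the support of the data
  obtain ⟨K, hK, hsupp⟩ := hψ.2.2
  obtain ⟨ρ, hρ, hKρ⟩ := exists_spatialNorm_le_of_isCompact hK
  -- a radius bound `> r₊` for (31), and a flat radius `R₁` beyond it
  set R' : ℝ := max R (Kerr.rPlus M a + 1) with hR'
  have hR'pos : Kerr.rPlus M a < R' := (lt_add_one _).trans_le (le_max_right _ _)
  set R₁ : ℝ := max R₀ (max ρ (R' + 1)) with hR₁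
  have hR₀₁ : R₀ ≤ R₁ := le_max_left _ _
  have hρ₁ : ρ ≤ R₁ := (le_max_left _ _).trans (le_max_right _ _)
  have hR'R₁ : R' < R₁ := (lt_add_one R').trans_le ((le_max_right _ _).trans (le_max_right _ _))
  have hRR₁ : R < R₁ := (le_max_left _ _).trans_lt hR'R₁
  have hR₁nn : 0 ≤ R₁ := hR₀.le.trans hR₀₁
  -- the support hypothesis in ball form
  have hdata : Kerr.HasBallData M a R₁ ψ := by
    intro x hx0 hxR
    refine hsupp x hx0 fun hxK ↦ ?_
    have := hKρ x hxK
    linarith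
  obtain ⟨C, hC⟩ := hcor R₁ hR₀₁ ψ hψ hdata δ hδ R' hR'pos hR'R₁
  refine ⟨6 * C ^ 2, fun τ hτ y hy hyR ↦ ?_⟩
  set h : E3 → ℝ := Kerr.cutoffHeight (σ M a) a R₁ with hh
  -- on `{‖y‖ ≤ R}` the leaf point is the slice point `(τ, y)` and the leaf normal is `V`
  have hlt : Kerr.radius a (E4.ofTimeSpace 0 y) < R₁ :=
    ((Kerr.radius_ofTimeSpace_le_norm a 0 y).trans hyR).trans_lt hRR₁
  have h0 : h y = 0 := Kerr.cutoffHeight_eq_zero_of_radius_le hR₁nn hlt.le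
  have hpt : Kerr.leafPoint h τ y = E4.ofTimeSpace τ y := Kerr.leafPoint_of_eq_zero h0 τ
  have hy' : Kerr.leafPoint h τ y ∈ Kerr.region a (Kerr.rPlus M a) := by
    rw [hpt]; exact hy
  have hrad : Kerr.radius a (Kerr.leafPoint h τ y) ≤ R' := by
    rw [hpt]
    exact ((Kerr.radius_ofTimeSpace_le_norm a τ y).trans hyR).trans (le_max_left _ _)
  have hbound := hC τ hτ y hy' hrad
  have hder : fderiv ℝ h (E4.spatial (Kerr.leafPoint h τ y)) = 0 := by
    rw [hpt, E4.spatial_ofTimeSpace]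
    exact Kerr.fderiv_cutoffHeight_eq_zero hR₁nn hlt
  have hN : Kerr.leafNormal M a h ⟨Kerr.leafPoint h τ y, hy'⟩ =
      Kerr.timeVector M a (Kerr.leafPoint h τ y) :=
    Kerr.leafNormal_eq_timeVector _ hder
  rw [hN] at hbound
  -- compare with the coordinate energy density at the slice point
  have hcmp :=
    Kerr.coordEnergyDensity_le_six_mul_sq_unitNormalDeriv_add_sqrt_tangentialGradSq hMa ψ hy'
  have h1 : coordEnergyDensity (Kerr.region a (Kerr.rPlus M a)) ψ (Kerr.leafPoint h τ y) ≤
      6 * (C * τ ^ (-2 + δ)) ^ 2 :=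
    hcmp.trans (by gcongr)
  rw [hpt] at h1
  have hτ0 : 0 ≤ τ := zero_le_one.trans hτ
  have key : (τ ^ (-2 + δ)) ^ 2 = τ ^ (-4 + 2 * δ) := by
    rw [← Real.rpow_two, ← Real.rpow_mul hτ0]
    congr 1
    ring
  calc coordEnergyDensity (Kerr.exterior M a) ψ (E4.ofTimeSpace τ y)
      ≤ 6 * (C * τ ^ (-2 + δ)) ^ 2 := h1
    _ = 6 * C ^ 2 * τ ^ (-4 + 2 * δ) := by rw [mul_pow, key]; ring

/-! ### The converse reduction on the flat part of the leaves, and the equivalence -/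

/-- **The converse reduction: DRSR's pointwise derivative decay in coordinate form implies (31)
on the flat part of the leaves of every cut-off graph foliation.** Let `σ M a` be any family of
far slopes and `h = Kerr.cutoffHeight (σ M a) a R₁`, `R₁ > r₊`. If
`Literature.Geometry.Lorentzian.drsr_wave_derivative_decay_kerr` holds
(`∑_μ (∂_μψ)²(t, y) ≤ C t^{-4+2δ}` at the slice points with `‖y‖ ≤ R'`, `t ≥ 1`), then for every
`R` with `r₊ < R < R₁` one has `|n_Σ̃ ψ|(p) + |∇_Σ̃ ψ|_ḡ(p) ≤ C' τ^{-2+δ}` (`τ ≥ 1`) at the exterior leaf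
points `p = Kerr.leafPoint h τ y` with `r(p) ≤ R`: there `r(0, y) = r(p) ≤ R < R₁`, so `h` vanishes
near `y` (`Kerr.cutoffHeight_eq_zero_of_radius_le`, `Kerr.fderiv_cutoffHeight_eq_zero`), `p` is
the slice point `(τ, y)` and the leaf normal is the slice normal `V`
(`Kerr.leafNormal_eq_timeVector`); `‖y‖ ≤ r + |a| ≤ R₁ + |a| =: R'`, and by the converse
comparison on the subextremal exterior
(`Kerr.unitNormalDeriv_sq_add_tangentialGradSq_le_thirty_mul_coordEnergyDensity`)
`(|nψ| + |∇_Σψ|_ḡ)² ≤ 2 ((nψ)² + |∇_Σψ|²_ḡ) ≤ 60 ∑_μ (∂_μψ)² ≤ 60 max(C, 0) τ^{-4+2δ}`, whence the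
claim with `C' = √(60 max(C, 0))`. The restriction `R < R₁` — to the part of the leaves where they
*are* the Kerr–Schild slices, which is the printed choice (DRSR arXiv:1402.7034, p. 51: the
hyperboloidal hypersurface "agrees with `Σ₀` on `{r ≤ R}`") and all that the forward reduction
`drsr_wave_derivative_decay_kerr_of_leaf_derivative_decay_lt` uses — is essential to this
elementary argument: on the bent part `{r > R₁}` the printed quantity refers to the normal of the
bent leaf, and its comparison with the coordinate gradient would need the uniform spacelikeness of
the leaves there (true for `Σ̃_τ(h♯_{R₁})`, `Kerr.leafConormal_coSharp_self_neg`, but not needed). In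
this direction neither the threshold `R₀` (here `r₊ + 1`) nor the support hypothesis
`Kerr.HasBallData` plays a role. DRSR arXiv:1402.7034, §3.1 (display following (23)), §3.3,
Cor. 3.1 (31) and p. 51. [folklore] -/
theorem leaf_derivative_decay_of_drsr_wave_derivative_decay_kerr (σ : ℝ → ℝ → ℝ → ℝ)
    (h : drsr_wave_derivative_decay_kerr) :
    ∀ [Kerr.Facts] [Kerr.SliceFacts] (M a : ℝ), Kerr.IsSubextremal M a →
      ∃ R₀ : ℝ, 0 < R₀ ∧ ∀ R₁ : ℝ, R₀ ≤ R₁ →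
        ∀ ψ : Kerr.region a (Kerr.rPlus M a) → ℝ, IsAdmissibleKerrWave M a ψ →
          Kerr.HasBallData M a R₁ ψ → ∀ δ : ℝ, 0 < δ → ∀ R : ℝ, Kerr.rPlus M a < R → R < R₁ →
            ∃ C : ℝ, ∀ τ : ℝ, 1 ≤ τ →
              ∀ (y : E3) (hy : Kerr.leafPoint (Kerr.cutoffHeight (σ M a) a R₁) τ y ∈
                  Kerr.region a (Kerr.rPlus M a)),
                Kerr.radius a (Kerr.leafPoint (Kerr.cutoffHeight (σ M a) a R₁) τ y) ≤ R →
                  |(Kerr.smoothMetric M a (Kerr.rPlus M a)).unitNormalDeriv ψ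
                      ⟨Kerr.leafPoint (Kerr.cutoffHeight (σ M a) a R₁) τ y, hy⟩
                      (Kerr.leafNormal M a (Kerr.cutoffHeight (σ M a) a R₁)
                        ⟨Kerr.leafPoint (Kerr.cutoffHeight (σ M a) a R₁) τ y, hy⟩)| +
                    Real.sqrt ((Kerr.smoothMetric M a (Kerr.rPlus M a)).tangentialGradSq ψ
                      ⟨Kerr.leafPoint (Kerr.cutoffHeight (σ M a) a R₁) τ y, hy⟩
                      (Kerr.leafNormal M a (Kerr.cutoffHeight (σ M a) a R₁)
                        ⟨Kerr.leafPoint (Kerr.cutoffHeight (σ M a) a R₁) τ y, hy⟩)) ≤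
                    C * τ ^ (-2 + δ) := by
  intro _ _ M a hMa
  -- threshold: any radius beyond the horizon
  refine ⟨Kerr.rPlus M a + 1, by linarith [hMa.rPlus_pos],
    fun R₁ hR₁ ψ hψ _hball δ hδ R _hR hRR₁ ↦ ?_⟩
  have hR₁nn : 0 ≤ R₁ := by linarith [hMa.rPlus_pos]
  -- the coordinate estimate on `{‖y‖ ≤ R₁ + |a|}`
  obtain ⟨C, hC⟩ := h M a hMa ψ hψ δ hδ (R₁ + |a|)
  refine ⟨Real.sqrt (60 * max C 0), fun τ hτ y hy hyR ↦ ?_⟩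
  set hgt : E3 → ℝ := Kerr.cutoffHeight (σ M a) a R₁ with hhgt
  -- the leaf point is the slice point `(τ, y)`, the leaf normal is `V`
  have hr0 : Kerr.radius a (Kerr.leafPoint hgt τ y) = Kerr.radius a (E4.ofTimeSpace 0 y) :=
    Kerr.radius_ofTimeSpace a _ y
  have hle : Kerr.radius a (E4.ofTimeSpace 0 y) ≤ R := hr0 ▸ hyR
  have hlt : Kerr.radius a (E4.ofTimeSpace 0 y) < R₁ := hle.trans_lt hRR₁
  have h0 : hgt y = 0 := Kerr.cutoffHeight_eq_zero_of_radius_le hR₁nn hlt.le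
  have hpt : Kerr.leafPoint hgt τ y = E4.ofTimeSpace τ y := Kerr.leafPoint_of_eq_zero h0 τ
  have hy' : E4.ofTimeSpace τ y ∈ Kerr.region a (Kerr.rPlus M a) := hpt ▸ hy
  have hrpos : 0 < Kerr.radius a (E4.ofTimeSpace 0 y) := by
    rw [← Kerr.radius_ofTimeSpace a τ y]
    exact Kerr.radius_pos_of_mem_region hy'
  have hnorm : ‖y‖ ≤ R₁ + |a| := by
    have h1 := Kerr.norm_le_radius_add_abs hrpos
    linarith
  have hced : coordEnergyDensity (Kerr.region a (Kerr.rPlus M a)) ψ (Kerr.leafPoint hgt τ y) ≤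
      C * τ ^ (-4 + 2 * δ) := by
    rw [hpt]
    exact hC τ hτ y hy' hnorm
  have hder : fderiv ℝ hgt (E4.spatial (Kerr.leafPoint hgt τ y)) = 0 := by
    rw [hpt, E4.spatial_ofTimeSpace]
    exact Kerr.fderiv_cutoffHeight_eq_zero hR₁nn hlt
  have hN : Kerr.leafNormal M a hgt ⟨Kerr.leafPoint hgt τ y, hy⟩ =
      Kerr.timeVector M a (Kerr.leafPoint hgt τ y) :=
    Kerr.leafNormal_eq_timeVector _ hder
  rw [hN]
  -- the converse comparison at the point
  have hcmp := Kerr.unitNormalDeriv_sq_add_tangentialGradSq_le_thirty_mul_coordEnergyDensity hMa ψ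
    ⟨Kerr.leafPoint hgt τ y, hy⟩
  have htg := Kerr.tangentialGradSq_timeVector_nonneg hMa.pos.le a (Kerr.rPlus M a) ψ
    ⟨Kerr.leafPoint hgt τ y, hy⟩
  dsimp only at hcmp htg
  set nd := (Kerr.smoothMetric M a (Kerr.rPlus M a)).unitNormalDeriv ψ ⟨Kerr.leafPoint hgt τ y, hy⟩
    (Kerr.timeVector M a (Kerr.leafPoint hgt τ y)) with hnd
  set tg := (Kerr.smoothMetric M a (Kerr.rPlus M a)).tangentialGradSq ψ ⟨Kerr.leafPoint hgt τ y, hy⟩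
    (Kerr.timeVector M a (Kerr.leafPoint hgt τ y)) with htg_def
  -- `(|nd| + √tg)² ≤ 2 (nd² + tg) ≤ 60 ∑(∂ψ)² ≤ 60 max(C, 0) τ^{-4+2δ} = (√(60 max(C,0)) τ^{-2+δ})²`
  have hS : (|nd| + Real.sqrt tg) ^ 2 ≤ 2 * (nd ^ 2 + tg) := by
    nlinarith [sq_nonneg (|nd| - Real.sqrt tg), sq_abs nd, Real.sq_sqrt htg]
  have hτ0 : 0 ≤ τ := zero_le_one.trans hτ
  have hpow : 0 ≤ τ ^ (-2 + δ) := Real.rpow_nonneg hτ0 _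
  have key : τ ^ (-4 + 2 * δ) = (τ ^ (-2 + δ)) ^ 2 := by
    rw [← Real.rpow_two, ← Real.rpow_mul hτ0]
    congr 1
    ring
  have hC0 : C * τ ^ (-4 + 2 * δ) ≤ max C 0 * τ ^ (-4 + 2 * δ) :=
    mul_le_mul_of_nonneg_right (le_max_left _ _) (Real.rpow_nonneg hτ0 _)
  have hsq : (|nd| + Real.sqrt tg) ^ 2 ≤ (Real.sqrt (60 * max C 0) * τ ^ (-2 + δ)) ^ 2 := by
    rw [mul_pow, Real.sq_sqrt (by positivity), ← key]
    linarith
  exact (pow_le_pow_iff_left₀ (by positivity) (mul_nonneg (Real.sqrt_nonneg _) hpow)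
    two_ne_zero).mp hsq

/-- **The two renderings of DRSR Cor. 3.1 (31) for compactly supported data are equivalent**:
through the flat part `{r < R₁}` of the leaves of a cut-off graph foliation (the printed
`sup_{Σ̃_τ ∩ {r ≤ R}} |n_Σ̃ ψ| + |∇_Σ̃ ψ| ≤ C τ^{-2+δ}` for hyperboloidal `Σ̃_τ` agreeing with the slices
on `{r ≤ R₁}`, `R < R₁`, DRSR p. 51), and in coordinate form
(`Literature.Geometry.Lorentzian.drsr_wave_derivative_decay_kerr`):
`drsr_wave_derivative_decay_kerr_of_leaf_derivative_decay_lt` and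
`leaf_derivative_decay_of_drsr_wave_derivative_decay_kerr`. In particular the named fact asserts
no more than the printed estimate on the region where it is invoked. DRSR arXiv:1402.7034, §3.3,
Cor. 3.1 (31) and p. 51. [folklore] -/
theorem drsr_wave_derivative_decay_kerr_iff_leaf_derivative_decay (σ : ℝ → ℝ → ℝ → ℝ) :
    drsr_wave_derivative_decay_kerr ↔
    ∀ [Kerr.Facts] [Kerr.SliceFacts] (M a : ℝ), Kerr.IsSubextremal M a →
      ∃ R₀ : ℝ, 0 < R₀ ∧ ∀ R₁ : ℝ, R₀ ≤ R₁ →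
        ∀ ψ : Kerr.region a (Kerr.rPlus M a) → ℝ, IsAdmissibleKerrWave M a ψ →
          Kerr.HasBallData M a R₁ ψ → ∀ δ : ℝ, 0 < δ → ∀ R : ℝ, Kerr.rPlus M a < R → R < R₁ →
            ∃ C : ℝ, ∀ τ : ℝ, 1 ≤ τ →
              ∀ (y : E3) (hy : Kerr.leafPoint (Kerr.cutoffHeight (σ M a) a R₁) τ y ∈
                  Kerr.region a (Kerr.rPlus M a)),
                Kerr.radius a (Kerr.leafPoint (Kerr.cutoffHeight (σ M a) a R₁) τ y) ≤ R →
                  |(Kerr.smoothMetric M a (Kerr.rPlus M a)).unitNormalDeriv ψ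
                      ⟨Kerr.leafPoint (Kerr.cutoffHeight (σ M a) a R₁) τ y, hy⟩
                      (Kerr.leafNormal M a (Kerr.cutoffHeight (σ M a) a R₁)
                        ⟨Kerr.leafPoint (Kerr.cutoffHeight (σ M a) a R₁) τ y, hy⟩)| +
                    Real.sqrt ((Kerr.smoothMetric M a (Kerr.rPlus M a)).tangentialGradSq ψ
                      ⟨Kerr.leafPoint (Kerr.cutoffHeight (σ M a) a R₁) τ y, hy⟩
                      (Kerr.leafNormal M a (Kerr.cutoffHeight (σ M a) a R₁)
                        ⟨Kerr.leafPoint (Kerr.cutoffHeight (σ M a) a R₁) τ y, hy⟩)) ≤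
                    C * τ ^ (-2 + δ) :=
  ⟨fun h _ _ M a hMa ↦ leaf_derivative_decay_of_drsr_wave_derivative_decay_kerr σ h M a hMa,
    fun h ↦ drsr_wave_derivative_decay_kerr_of_leaf_derivative_decay_lt σ fun M a hMa ↦ h M a hMa⟩

namespace Kerr

/-- **(31) on the flat part of the foliation `Σ̃_τ(h♯_{R₁})` from the coordinate form**: the leaf
form of DRSR Cor. 3.1 (31) for the hyperboloidal foliation terminating at `𝓘⁺`
(`KerrHyperboloidalFlux.lean`), restricted to the radii `r₊ < R < R₁` where its leaves are the
Kerr–Schild slices, follows from `Literature.Geometry.Lorentzian.drsr_wave_derivative_decay_kerr`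
(instance `σ = Kerr.scriSlope` of `leaf_derivative_decay_of_drsr_wave_derivative_decay_kerr`;
`Kerr.scriHeight M a R₁ = Kerr.cutoffHeight (Kerr.scriSlope M a) a R₁` definitionally). DRSR
arXiv:1402.7034, §3.3, Cor. 3.1 (31) and p. 51. [folklore] -/
theorem scri_leaf_derivative_decay_of_drsr_wave_derivative_decay_kerr
    (h : Literature.Geometry.Lorentzian.drsr_wave_derivative_decay_kerr) :
    ∀ [Facts] [SliceFacts] (M a : ℝ), IsSubextremal M a →
      ∃ R₀ : ℝ, 0 < R₀ ∧ ∀ R₁ : ℝ, R₀ ≤ R₁ →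
        ∀ ψ : region a (rPlus M a) → ℝ, Literature.Geometry.Lorentzian.IsAdmissibleKerrWave M a ψ →
          HasBallData M a R₁ ψ → ∀ δ : ℝ, 0 < δ → ∀ R : ℝ, rPlus M a < R → R < R₁ →
            ∃ C : ℝ, ∀ τ : ℝ, 1 ≤ τ →
              ∀ (y : E3) (hy : leafPoint (scriHeight M a R₁) τ y ∈ region a (rPlus M a)),
                radius a (leafPoint (scriHeight M a R₁) τ y) ≤ R →
                  |(smoothMetric M a (rPlus M a)).unitNormalDeriv ψ
                      ⟨leafPoint (scriHeight M a R₁) τ y, hy⟩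
                      (leafNormal M a (scriHeight M a R₁) ⟨leafPoint (scriHeight M a R₁) τ y, hy⟩)| +
                    Real.sqrt ((smoothMetric M a (rPlus M a)).tangentialGradSq ψ
                      ⟨leafPoint (scriHeight M a R₁) τ y, hy⟩
                      (leafNormal M a (scriHeight M a R₁)
                        ⟨leafPoint (scriHeight M a R₁) τ y, hy⟩)) ≤
                    C * τ ^ (-2 + δ) :=
  fun M a hMa ↦ leaf_derivative_decay_of_drsr_wave_derivative_decay_kerr scriSlope h M a hMa

/-- **The leaf form of DRSR Cor. 3.1 (31) on the flat part of `Σ̃_τ(h♯_{R₁})` is equivalent to the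
gr.S24 named fact `Literature.Geometry.Lorentzian.drsr_wave_derivative_decay_kerr`** (both render
the printed estimate (31) for compactly supported data on the region `{r ≤ R}`, `R < R₁`, where the
hyperboloidal leaves are chosen to agree with the slices, DRSR p. 51): instance `σ = Kerr.scriSlope`
of `drsr_wave_derivative_decay_kerr_iff_leaf_derivative_decay`. The unrestricted leaf form (all
`R > r₊`, the hypothesis of `drsr_wave_derivative_decay_kerr_of_scri_leaf_derivative_decay`)
implies both. DRSR arXiv:1402.7034, §3.3, Cor. 3.1 (31) and p. 51. [folklore] -/
theorem scri_leaf_derivative_decay_iff :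
    (∀ [Facts] [SliceFacts] (M a : ℝ), IsSubextremal M a →
      ∃ R₀ : ℝ, 0 < R₀ ∧ ∀ R₁ : ℝ, R₀ ≤ R₁ →
        ∀ ψ : region a (rPlus M a) → ℝ, Literature.Geometry.Lorentzian.IsAdmissibleKerrWave M a ψ →
          HasBallData M a R₁ ψ → ∀ δ : ℝ, 0 < δ → ∀ R : ℝ, rPlus M a < R → R < R₁ →
            ∃ C : ℝ, ∀ τ : ℝ, 1 ≤ τ →
              ∀ (y : E3) (hy : leafPoint (scriHeight M a R₁) τ y ∈ region a (rPlus M a)),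
                radius a (leafPoint (scriHeight M a R₁) τ y) ≤ R →
                  |(smoothMetric M a (rPlus M a)).unitNormalDeriv ψ
                      ⟨leafPoint (scriHeight M a R₁) τ y, hy⟩
                      (leafNormal M a (scriHeight M a R₁) ⟨leafPoint (scriHeight M a R₁) τ y, hy⟩)| +
                    Real.sqrt ((smoothMetric M a (rPlus M a)).tangentialGradSq ψ
                      ⟨leafPoint (scriHeight M a R₁) τ y, hy⟩
                      (leafNormal M a (scriHeight M a R₁)
                        ⟨leafPoint (scriHeight M a R₁) τ y, hy⟩)) ≤
                    C * τ ^ (-2 + δ)) ↔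
      Literature.Geometry.Lorentzian.drsr_wave_derivative_decay_kerr :=
  ⟨fun h ↦ drsr_wave_derivative_decay_kerr_of_leaf_derivative_decay_lt scriSlope
      fun M a hMa ↦ h M a hMa,
    fun h ↦ by
      intro _ _ M a hMa
      exact scri_leaf_derivative_decay_of_drsr_wave_derivative_decay_kerr h M a hMa⟩

end Kerr

end Literature.Geometry.Lorentzian

end
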